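import Mathlib
import Summits.Ventures.HodgeRepro2.BallQuotientComplexManifold

/-!
# Holomorphic functions on `Γ\𝔹²` are the `Γ`-invariant holomorphic functions on `𝔹²`

Kernel annex of the blind cell `pub-hodge-repro2` (seat p2), Tier-3 hypothesis shapes of
`Hypothesis.lean`.  For the complex-manifold structure of `BallQuotientComplexManifold.lean`
on `Γ\𝔹²` (pushed forward along the quotient map `mk : 𝔹² → Γ\𝔹²`):

* `continuous_ballQuotient_iff`: a map out of `Γ\𝔹²` is continuous iff its pull-back to the ball
  is (the quotient map is an open quotient map, `BallQuotientHausdorff.lean`);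
* `contMDiff_ballQuotient_iff`: a map `φ : Γ\𝔹² → F` into a complex normed space is `C^ω`
  (holomorphic) iff `φ ∘ mk` is `C^ω` on the ball;
* `ballQuotientLift` / `contMDiff_ballQuotientLift`: conversely, a `Γ`-invariant `C^ω` function on
  the ball descends to a `C^ω` function on `Γ\𝔹²` — the degree-0 instance of the dictionary
  «automorphic forms on the ball = holomorphic objects on the surface» that the objects
  `q₁, q₂` of `NonVanishingInput` (invariant holomorphic 1-forms on the ball) use in degree 1.
-/

namespace Summit.Ventures.HodgeRepro2.ShimuraData

open scoped ContDiff Manifold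
open Topology Filter

variable {K : Type*} [Field K] [NumberField K] [NumberField.IsCMField K]
  {τ₁ : K →+* ℂ} {H : Matrix (Fin 3) (Fin 3) K} {Q : Matrix (Fin 3) (Fin 3) ℂ}
  (hQ : IsFrame K τ₁ H Q) (S : Subgroup (GL (Fin 3) K))
  (hS : (S : Set (GL (Fin 3) K)) ⊆ (unitaryGroup K H : Set (GL (Fin 3) K)))

section continuous

variable {F : Type*} [TopologicalSpace F]

/-- A map out of `Γ\𝔹²` is continuous iff its pull-back to the ball is continuous. -/
theorem continuous_ballQuotient_iff {φ : ballQuotient hQ S hS → F} :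
    Continuous φ ↔ Continuous (φ ∘ ballQuotient.mk hQ S hS) :=
  (isOpenQuotientMap_ballQuotient_mk hQ S hS).isQuotientMap.continuous_iff

end continuous

section holomorphic

variable {F : Type*} [NormedAddCommGroup F] [NormedSpace ℂ F]

/-- **Holomorphic descent for functions.** For the atlas pushed forward from the ball, a map
`φ : Γ\𝔹² → F` is `C^ω` iff `φ ∘ mk : 𝔹² → F` is `C^ω`: in the chart at `x = mk z` the map `φ`
reads `φ ∘ mk ∘ (inclusion)⁻¹`, which is `φ ∘ mk` read in the chart of the ball. -/
theorem contMDiff_ballQuotient_iff (hf : IsLocalHomeomorph (ballQuotient.mk hQ S hS))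
    {φ : ballQuotient hQ S hS → F} :
    @ContMDiff ℂ _ (Fin 2 → ℂ) _ _ (Fin 2 → ℂ) _ 𝓘(ℂ, Fin 2 → ℂ) (ballQuotient hQ S hS) _
        (ballQuotientChartedSpace hQ S hS hf) F _ _ F _ 𝓘(ℂ, F) F _ _ ω φ ↔
      ContMDiff 𝓘(ℂ, Fin 2 → ℂ) 𝓘(ℂ, F) ω (φ ∘ ballQuotient.mk hQ S hS) := by
  letI := ballQuotientChartedSpace hQ S hS hf
  constructor
  · intro hφ
    exact hφ.comp (contMDiff_ballQuotient_mk hQ S hS hf)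
  · intro hψ x
    rw [contMDiffAt_iff]
    refine ⟨((continuous_ballQuotient_iff hQ S hS).2 hψ.continuous).continuousAt, ?_⟩
    obtain ⟨z', hz'src, hz'⟩ := exists_chartAt_eq_ballQuotientChartedSpace hQ S hS hf x
    simp only [extChartAt, OpenPartialHomeomorph.extend, modelWithCornersSelf_coe,
      modelWithCornersSelf_coe_symm, PartialEquiv.coe_trans, ModelWithCorners.toPartialEquiv_coe,
      OpenPartialHomeomorph.coe_toPartialEquiv, ModelWithCorners.toPartialEquiv_coe_symm,
      PartialEquiv.coe_trans_symm, OpenPartialHomeomorph.coe_toPartialEquiv_symm, Set.range_id,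
      contDiffWithinAt_univ, Function.comp_id, Function.id_comp, chartAt_self_eq,
      OpenPartialHomeomorph.refl_apply]
    rw [hz']
    -- the point of the ball above `x` chosen by the chart
    set z := hf.localInverseAt z' x with hz
    have hzb : (z : Fin 2 → ℂ) ∈ ball₂ := z.2
    have hmain := hψ z
    rw [contMDiffAt_iff] at hmain
    obtain ⟨-, hmain⟩ := hmain
    simp only [extChartAt, OpenPartialHomeomorph.extend, modelWithCornersSelf_coe,
      modelWithCornersSelf_coe_symm, PartialEquiv.coe_trans, ModelWithCorners.toPartialEquiv_coe,
      OpenPartialHomeomorph.coe_toPartialEquiv, ModelWithCorners.toPartialEquiv_coe_symm,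
      PartialEquiv.coe_trans_symm, OpenPartialHomeomorph.coe_toPartialEquiv_symm, Set.range_id,
      contDiffWithinAt_univ, Function.comp_id, Function.id_comp, chartAt_self_eq,
      OpenPartialHomeomorph.refl_apply, ball₂.coe_chartAt] at hmain
    -- both sides are `φ ∘ mk ∘ (chart of the ball)⁻¹` at the point `↑z`
    have hpt : ((hf.localInverseAt z').trans (chartAt (Fin 2 → ℂ) z')) x = (z : Fin 2 → ℂ) := by
      rw [OpenPartialHomeomorph.coe_trans, Function.comp_apply, ball₂.coe_chartAt]
    rw [hpt]
    refine hmain.congr_of_eventuallyEq (Filter.Eventually.of_forall fun w => ?_)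
    simp only [Function.comp_apply, OpenPartialHomeomorph.trans_symm_eq_symm_trans_symm,
      OpenPartialHomeomorph.coe_trans, hf.localInverseAt_symm]
    rfl

/-- The ℂ-valued case: holomorphic functions on `Γ\𝔹²` are exactly the functions whose
pull-back to the ball is holomorphic. -/
theorem contMDiff_ballQuotient_iff' (hf : IsLocalHomeomorph (ballQuotient.mk hQ S hS))
    {φ : ballQuotient hQ S hS → ℂ} :
    @ContMDiff ℂ _ (Fin 2 → ℂ) _ _ (Fin 2 → ℂ) _ 𝓘(ℂ, Fin 2 → ℂ) (ballQuotient hQ S hS) _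
        (ballQuotientChartedSpace hQ S hS hf) ℂ _ _ ℂ _ 𝓘(ℂ) ℂ _ _ ω φ ↔
      ContMDiff 𝓘(ℂ, Fin 2 → ℂ) 𝓘(ℂ) ω (φ ∘ ballQuotient.mk hQ S hS) :=
  contMDiff_ballQuotient_iff hQ S hS hf

end holomorphic

section descent

variable {F : Type*}

/-- A `Γ`-invariant function on the ball descends to the quotient `Γ\𝔹²`. -/
noncomputable def ballQuotientLift (ψ : ball₂ → F)
    (hinv : letI := frameAction hQ S hS; ∀ (γ : S) (z : ball₂), ψ (γ • z) = ψ z)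
    (x : ballQuotient hQ S hS) : F :=
  letI := frameAction hQ S hS
  Quotient.liftOn' x ψ fun a b hab => by
    obtain ⟨γ, hγ⟩ := (ballQuotient_mk_eq_mk_iff_exists_smul hQ S hS a b).1 (Quotient.sound' hab)
    rw [← hγ, hinv γ a]

/-- The descended function pulls back to the original one. -/
@[simp]
theorem ballQuotientLift_mk (ψ : ball₂ → F)
    (hinv : letI := frameAction hQ S hS; ∀ (γ : S) (z : ball₂), ψ (γ • z) = ψ z)
    (z : ball₂) : ballQuotientLift hQ S hS ψ hinv (ballQuotient.mk hQ S hS z) = ψ z :=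
  rfl

/-- The descended function is the unique function with that pull-back. -/
theorem ballQuotientLift_comp_mk (ψ : ball₂ → F)
    (hinv : letI := frameAction hQ S hS; ∀ (γ : S) (z : ball₂), ψ (γ • z) = ψ z) :
    ballQuotientLift hQ S hS ψ hinv ∘ ballQuotient.mk hQ S hS = ψ :=
  rfl

/-- A `Γ`-invariant continuous function on the ball descends to a continuous function. -/
theorem continuous_ballQuotientLift [TopologicalSpace F] {ψ : ball₂ → F} (hψ : Continuous ψ)
    (hinv : letI := frameAction hQ S hS; ∀ (γ : S) (z : ball₂), ψ (γ • z) = ψ z) :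
    Continuous (ballQuotientLift hQ S hS ψ hinv) :=
  (continuous_ballQuotient_iff hQ S hS).2 hψ

/-- **Descent of holomorphic functions.** A `Γ`-invariant `C^ω` function on the ball descends
to a `C^ω` function on `Γ\𝔹²`. -/
theorem contMDiff_ballQuotientLift [NormedAddCommGroup F] [NormedSpace ℂ F]
    (hf : IsLocalHomeomorph (ballQuotient.mk hQ S hS)) {ψ : ball₂ → F}
    (hψ : ContMDiff 𝓘(ℂ, Fin 2 → ℂ) 𝓘(ℂ, F) ω ψ)
    (hinv : letI := frameAction hQ S hS; ∀ (γ : S) (z : ball₂), ψ (γ • z) = ψ z) :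
    @ContMDiff ℂ _ (Fin 2 → ℂ) _ _ (Fin 2 → ℂ) _ 𝓘(ℂ, Fin 2 → ℂ) (ballQuotient hQ S hS) _
      (ballQuotientChartedSpace hQ S hS hf) F _ _ F _ 𝓘(ℂ, F) F _ _ ω
      (ballQuotientLift hQ S hS ψ hinv) :=
  (contMDiff_ballQuotient_iff hQ S hS hf).2 hψ

end descent

end Summit.Ventures.HodgeRepro2.ShimuraData
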